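import Summits.CriticalPhenomena.PercolationContinuityZ3.Theorems.Transplant.SkelPhiCellsWeakGLevelsS
import Summits.CriticalPhenomena.PercolationContinuityZ3.Theorems.Transplant.TwoAxisParaCellsFineRep
import HarnessLib

/-!
# N2 (frames-only node `SamePDropOfSkeletonFrm₁`, OPEN), WAVE-1 Geom re-base, part 3: the SCHEME GEOMETRY OF THE FINE CELLS over STAGGERED cells in
# one theorem — `Lip`, `RunGeom`, `AnchGeom`, `SepGeom₂`, `ExitGeom`, `StepsGeom`, `LevelGeom`, `QSepGeom` of `cellGeomSG₂S G ψ P t Λ` at the fine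
# cell map `ψ = fineSkel φ t A n h vα vβ c₀ c₁ (D/2) (D/2) D`; the `PCells2S` twin of hp-8 g33's `SkelPhiCellsFineGeom`

builds on p205010 (kernel theorem, internal audit signed; external expert review pending) — nothing in this file uses p205010; nothing here is a
claim about the open node `SamePDropOfSkeletonFrm₁` (`SamePDropOfSkeletonNeg₁` is CLOSED in the tree and untouched by this file).
Lane `prim-bschramm`, seat `prim-hp-8` (gen 40); helper file (`--supports stmt-CriticalPhenomena-4575 --as helper`); design owner p3-g15 ((R-22)).
WHAT CHANGES against `SkelPhiCellsFineGeom`: the column point of the cube `Q x` is the vertex over the STAGGERED centre `cenS x` (`hcol_fineSkelS`, from the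
fine representative lemma `exists_mem_graphBall_fineSkel_eq` at the point `cenS x`), so the cube-radius slot reads `‖rep₂ (cenS x)‖₁ + 1 ≤ rQ a x`
(`hcolQ`; stmt's schedule slot); the well-formedness `WFS2` stays at `P.toPCells2` (numbers).
* `hcol_fineSkelS`, **`geom_fineSkelS`** (the eight facts).
[cite: KozmaNitzan2024, §4 pp. 25–31] [cite: MartineauTassion2017, §4.3]
-/

noncomputable section

open scoped Classical

namespace Summit.CriticalPhenomena.PercolationContinuityZ3.Theorems

namespace Transplant

namespace Skelφ

open Literature.Probability.Percolation Literature.Probability.LatticeModels SimpleGraph KNCells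
open Literature.Probability.Percolation.KozmaNitzan
open Literature.Barriers.CriticalPhenomena (graphBall graphBall_finite mem_graphBall_self graphBall_mono)
open BoxProdZ2 (ConcRadiiG)
open TwoAxis.Para (detD rep₂)

variable {V : Type} [DecidableEq V] {G : SimpleGraph V} [G.LocallyFinite] {φ : V → Site 2}

omit [DecidableEq V] in
/-- **The column vertex over the staggered centre**: a vertex `y` with `fineSkel … y = cenS x` inside the cube window `VWin ψ t (Q x) R` as soon as
`R ≥ ‖rep₂ (cenS x)‖₁ + 1` (the fine representative of `cenS x` and a weak-step neighbour, both in `Q x`). [this work] -/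
theorem hcol_fineSkelS [DecidableEq V] (hlip : Lip G φ) (hstep : Steps G φ) (t : V) {A n h vα vβ c₀ c₁ : ℤ} (hc₀ : 0 < c₀) (hc₁ : 0 < c₁)
    (hD : 0 < detD A n h vα vβ) (hL0 : c₀ * (|A| * (|vβ| + |vα|)) + 2 ≤ detD A n h vα vβ)
    (hL1 : c₁ * (|A| * (|n| + |h|)) + 2 ≤ detD A n h vα vβ) (P : PCells2S) (x : Site 2) {R : ℕ}
    (hR : (rep₂ A n h vα vβ c₀ c₁ (PCells2S.cenS P x) 0).natAbs + (rep₂ A n h vα vβ c₀ c₁ (PCells2S.cenS P x) 1).natAbs + 1 ≤ R) :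
    ∃ y ∈ VWin G (fineSkel φ t A n h vα vβ c₀ c₁ (detD A n h vα vβ / 2) (detD A n h vα vβ / 2) (detD A n h vα vβ)) t (PCells2S.Q P x) R,
      fineSkel φ t A n h vα vβ c₀ c₁ (detD A n h vα vβ / 2) (detD A n h vα vβ / 2) (detD A n h vα vβ) y = PCells2S.cenS P x := by
  obtain ⟨g, hg, hgz⟩ := exists_mem_graphBall_fineSkel_eq hstep t hc₀ hc₁ hD hL0 hL1 (P.cenS x)
  have hlipψ : Lip G (fineSkel φ t A n h vα vβ c₀ c₁ (detD A n h vα vβ / 2) (detD A n h vα vβ / 2) (detD A n h vα vβ)) :=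
    lip_fineSkel hlip t hc₀.le hc₁.le hD (by linarith) (by linarith)
  -- a weak-step neighbour stays in the cube `Q x` (its centre ± 1)
  obtain ⟨m, hadj, -⟩ := weakSteps_fineSkel hstep t hD hc₀.le hc₁.le (A := A) (n := n) (h := h) (vα := vα) (vβ := vβ)
    (s₀ := detD A n h vα vβ / 2) (s₁ := detD A n h vα vβ / 2) g 0 1
  have hQ : ∀ s : Site 2, (∀ i, |s i - P.cenS x i| ≤ 1) → s ∈ P.Q x := fun s hs => by
    rw [PCells2S.Q, PCells2S.mem_aboxS_iff]
    intro i
    have := abs_le.1 (hs i); have := P.one_le_r i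
    push_cast; constructor <;> omega
  have hgQ : fineSkel φ t A n h vα vβ c₀ c₁ (detD A n h vα vβ / 2) (detD A n h vα vβ / 2) (detD A n h vα vβ) g ∈ P.Q x :=
    hQ _ fun i => by rw [hgz]; simp
  have hmQ : fineSkel φ t A n h vα vβ c₀ c₁ (detD A n h vα vβ / 2) (detD A n h vα vβ / 2) (detD A n h vα vβ) m ∈ P.Q x :=
    hQ _ fun i => by
      have := hlipψ hadj i
      rw [hgz] at this
      rw [abs_sub_comm]; exact this
  exact ⟨g, mem_VWin_of_adj hg hR hgQ hadj hmQ, hgz⟩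

/-- **THE SCHEME GEOMETRY OF THE FINE CELLS OVER STAGGERED CELLS**: at `ψ := fineSkel φ t A n h vα vβ c₀ c₁ (D/2) (D/2) D` (`D = det`), for staggered
cells `P : PCells2S` and a schedule `Λ` with `WFS2 P.toPCells2 Λ` whose cube radii cover the fine column points over the staggered centres, the record
`cellGeomSG₂S G ψ P t Λ` (root `t`) has `Lip ψ` and all of `RunGeom/AnchGeom/SepGeom₂/ExitGeom/StepsGeom/LevelGeom/QSepGeom`.
[cite: KozmaNitzan2024, §4 pp. 25–31] -/
theorem geom_fineSkelS (hlip : Lip G φ) (hstep : Steps G φ) (t : V) {A n h vα vβ c₀ c₁ : ℤ} (hc₀ : 0 < c₀) (hc₁ : 0 < c₁)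
    (hD : 0 < detD A n h vα vβ) (hL0 : c₀ * (|A| * (|vβ| + |vα|)) + 2 ≤ detD A n h vα vβ)
    (hL1 : c₁ * (|A| * (|n| + |h|)) + 2 ≤ detD A n h vα vβ) (P : PCells2S) {Λ : ConcRadiiG} (hΛ : WFS2 P.toPCells2 Λ)
    (hcolQ : ∀ a x, (rep₂ A n h vα vβ c₀ c₁ (PCells2S.cenS P x) 0).natAbs + (rep₂ A n h vα vβ c₀ c₁ (PCells2S.cenS P x) 1).natAbs + 1 ≤ Λ.rQ a x) :
    let ψ := fineSkel φ t A n h vα vβ c₀ c₁ (detD A n h vα vβ / 2) (detD A n h vα vβ / 2) (detD A n h vα vβ)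
    Lip G ψ ∧ RunGeom G (cellGeomSG₂S G ψ P t Λ) ∧ AnchGeom (cellGeomSG₂S G ψ P t Λ) ∧ SepGeom₂ G (cellGeomSG₂S G ψ P t Λ) ∧
      ExitGeom G (cellGeomSG₂S G ψ P t Λ) ∧ StepsGeom (cellGeomSG₂S G ψ P t Λ) (faceDataSGS G ψ P t Λ) ∧
      LevelGeom G (cellGeomSG₂S G ψ P t Λ) (faceDataSGS G ψ P t Λ) (levelDataSS ψ P) ∧ QSepGeom G (cellGeomSG₂S G ψ P t Λ) := by
  intro ψ
  have hlipψ : Lip G ψ := lip_fineSkel hlip t hc₀.le hc₁.le hD (by linarith) (by linarith)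
  have hws : WeakSteps G ψ := weakSteps_fineSkel hstep t hD hc₀.le hc₁.le
  have hψ0 : ψ t = 0 := by
    have hD2 : 0 ≤ detD A n h vα vβ / 2 := Int.ediv_nonneg hD.le (by norm_num)
    have hD2' : detD A n h vα vβ / 2 < detD A n h vα vβ := by omega
    have h0 : TwoAxis.Para.coarse c₀ (detD A n h vα vβ / 2) (detD A n h vα vβ) 0 = 0 := by
      unfold TwoAxis.Para.coarse; rw [mul_zero, zero_add]; exact Int.ediv_eq_zero_of_lt hD2 hD2'
    have h1 : TwoAxis.Para.coarse c₁ (detD A n h vα vβ / 2) (detD A n h vα vβ) 0 = 0 := by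
      unfold TwoAxis.Para.coarse; rw [mul_zero, zero_add]; exact Int.ediv_eq_zero_of_lt hD2 hD2'
    have hrel : relφ φ t t = 0 := by funext i; simp [relφ]
    funext i
    fin_cases i
    · show ψ t 0 = 0
      simp only [ψ, fineSkel_apply_zero, hrel]; unfold TwoAxis.Para.lam0; simp [h0]
    · show ψ t 1 = 0
      simp only [ψ, fineSkel_apply_one, hrel]; unfold TwoAxis.Para.lam1 TwoAxis.Para.bp; simp [h1]
  have hcol : ∀ a x, ∃ y ∈ VWin G ψ t (PCells2S.Q P x) (Λ.rQ a x), ψ y = PCells2S.cenS P x := fun a x =>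
    hcol_fineSkelS hlip hstep t hc₀ hc₁ hD hL0 hL1 P x (hcolQ a x)
  exact ⟨hlipψ, runGeomSG₂S P t, anchGeomSG₂S P t, sepGeom₂SG₂S P t hΛ hψ0 hlipψ hws hcol, exitGeomSG₂S P t hΛ hlipψ, stepsGeomSG₂S P t hΛ hlipψ hws,
    levelGeomSG₂S P t hΛ hlipψ, qSepGeomSG₂S P t hlipψ⟩

end Skelφ

end Transplant

end Summit.CriticalPhenomena.PercolationContinuityZ3.Theorems

end
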